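import Summits.MatrixMultiplication.MatrixMultiplication.Theorems.FarEdgeDescentLineDetPair
import Summits.MatrixMultiplication.MatrixMultiplication.Theorems.FarEdgeDescentStratumSymmetries
import Summits.MatrixMultiplication.MatrixMultiplication.Theorems.FarEdgeDescentZeroWeightBorderRank
import HarnessLib

/-!
# The BCZ line is degeneration-rigid, II: `𝔖(q) ⊵ 𝔖(q')` iff `q' ∈ {q, q⁻¹}`

Route `FarEdgeDescent` (cell `decomp-mm`, lens 2 «structural dichotomy (special vs generic)»,
gen 37), Kernel XII; support for the aside `SubLogRate` (stmt-MatrixMultiplication-25371).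

The same-support class of `⟨2,2,2⟩` is, up to `(GL₄)³`, the closed line `{𝔖(q) : q ∈ K}`
(Bläser–Christandl–Zuiddam normal form; `FarEdgeDescentWeightFamily.fam`): `𝔖(1) ≅ ⟨2,2,2⟩` is the
SPECIAL member, `𝔖(q)`, `q ∉ {0,1}`, the GENERIC stratum, `𝔖(0) = ⟨2,2,2⟩` minus one term.  The
tree knew `⟨2,2,2⟩ ⋈ 𝔖(q)` (`q ∉ {0,1}`; `FarEdgeDescentWeightFamily{,Det}`), four generic classes
pairwise (`FarEdgeDescentGenericAntichain`, char `≠ 2`) and `𝔖(q) ≥ 𝔖(q⁻¹)`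
(`FarEdgeDescentStratumSymmetries`).  This file DECIDES the degeneration order on the whole line,
over every field, except for the pairs `𝔖(q) → 𝔖(0)`, `q ∉ {0,1}`:

* `det_Tmat_fam`: the `x`-pencil of `𝔖(q)` has determinant `det X · det_q X`;
* `fam_algDegeneratesTo_fam_imp`: **`𝔖(q) ⊵ 𝔖(q')` with `q' ≠ 0` forces `q' = q ∨ q q' = 1`**
  (all `q`; the determinant classes of both pencils, `FarEdgeDescentLineDetPair`);
* `fam_algDegeneratesTo_fam_iff`: **for `q' ≠ 0 ∨ q ∈ {0,1}`:
  `𝔖(q) ⊵ 𝔖(q') ↔ q' = q ∨ q q' = 1 ↔ 𝔖(q) ≥ 𝔖(q')`** — on the BCZ line degeneration is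
  restriction is the inversion involution: the generic stratum is a continuum of pairwise
  incomparable classes `{𝔖(q), 𝔖(q⁻¹)}` (`generic_pair_incomparable`), and no strict degeneration
  exists along the line (`line_symmetric`);
* `matMul_not_algDegeneratesTo_fam_zero`: **`⟨2,2,2⟩ ⋭ 𝔖(0)`** — deleting one term of `⟨2,2,2⟩` is
  not a degeneration (no toric or other one-parameter family does it), every field; with
  `FarEdgeDescentWeightFamilyDet.fam_zero_not_algDegeneratesTo_matMul` the special member `𝔖(0)` of
  the corank-one stratum is `⊴`-incomparable with `⟨2,2,2⟩` (`matMul_fam_zero_incomparable`), and it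
  reaches no other member of the line (`fam_zero_not_algDegeneratesTo_fam`);
* `matMul_not_algDegeneratesTo_fam_detClass`: `⟨2,2,2⟩ ⋭ 𝔖(q)` for all `q ≠ 1` by the determinant
  class alone — `q = 0` and characteristic `2` included (the commutant proof needed `q ≠ 0`).

Lens reading: every finite-level (`N = 1`) degeneration relation inside the same-support class of
`⟨2,2,2⟩` is an isomorphism; transfer of `R̃` along the line (all members share support, flattening
ranks, the quantum functionals and, over `ℂ`, border rank `7` off `q = 0`) cannot come from
degeneration — it is genuinely asymptotic (FiniteSaturation / AnchoredLogConvexity untouched).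

References: M. Bläser, M. Christandl, J. Zuiddam, arXiv:1705.09652, §2, Lemma 3
[BlaserChristandlZuiddam2017]; P. Bürgisser, M. Clausen, M. A. Shokrollahi, *Algebraic Complexity
Theory* (1997), (15.19), §20.2 [BurgisserClausenShokrollahi1997]; J. M. Landsberg, *Geometry and
Complexity Theory* (2017), §3.4.4 (toric degenerations of `M_⟨n⟩`) [Landsberg2017].
-/

noncomputable section

open scoped BigOperators Polynomial

set_option linter.dupNamespace false

namespace Summit.MatrixMultiplication.MatrixMultiplication.Theorems.FarEdgeDescentLineRigidity

open Literature.Computability.AlgebraicComplexity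
open Summit.MatrixMultiplication.MatrixMultiplication.Theorems.FarEdgeDescentSignTwist
open Summit.MatrixMultiplication.MatrixMultiplication.Theorems.FarEdgeDescentSignTwistDet
open Summit.MatrixMultiplication.MatrixMultiplication.Theorems.FarEdgeDescentWeightFamily
  (famW fam fam_one)
open Summit.MatrixMultiplication.MatrixMultiplication.Theorems.FarEdgeDescentWeightFamilyDet
open Summit.MatrixMultiplication.MatrixMultiplication.Theorems.FarEdgeDescentLineDetPair
open Summit.MatrixMultiplication.MatrixMultiplication.Theorems.FarEdgeDescentStratumSymmetries
  (fam_restrictsTo_fam_inv)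
open Summit.MatrixMultiplication.MatrixMultiplication.Theorems.FarEdgeDescentZeroWeightBorderRank
  (fam_one_restricts)

universe u

/-! ## The field endgame -/

section Endgame
variable {K : Type u} [Field K]

/-- **The endgame**: for `{f₁, f₂} = {1, q'}`, `q ≠ 1`, `q' ≠ 0`, the least-order equations force
`q' = q` or `q q' = 1`. [folklore] -/
theorem endgame {q q' f₁ f₂ α α' : K} (hq1 : q ≠ 1) (hq'0 : q' ≠ 0)
    (hf : (f₁ = 1 ∧ f₂ = q') ∨ (f₁ = q' ∧ f₂ = 1)) (hne : α ≠ 0 ∨ α' ≠ 0)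
    (C1 : (α - α') * (α' * f₂ - α * f₁) = 0)
    (C2 : (q * α - α') * (α' * f₂ - q * α * f₁) = 0) : q' = q ∨ q * q' = 1 := by
  have hq1' : (q - 1 : K) ≠ 0 := sub_ne_zero.mpr hq1
  have key : α = 0 → α' = 0 → False := fun h h' => by
    rcases hne with h0 | h0
    · exact h0 h
    · exact h0 h'
  have hqα : (q - 1) * α = 0 → α = 0 := fun h => (mul_eq_zero.mp h).resolve_left hq1'
  rcases hf with ⟨hf₁, hf₂⟩ | ⟨hf₁, hf₂⟩ <;> rw [hf₁, hf₂] at C1 C2 <;>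
    rcases mul_eq_zero.mp C1 with h1 | h1 <;> rcases mul_eq_zero.mp C2 with h2 | h2
  · have hα0 := hqα (by linear_combination h2 - h1)
    exact (key hα0 (by linear_combination hα0 - h1)).elim
  · rcases mul_eq_zero.mp (show (q' - q) * α = 0 by linear_combination h2 + q' * h1) with h | h
    · exact Or.inl (sub_eq_zero.mp h)
    · exact (key h (by linear_combination h - h1)).elim
  · rcases mul_eq_zero.mp (show (q * q' - 1) * α = 0 by linear_combination q' * h2 + h1)
      with h | h
    · exact Or.inr (by linear_combination h)
    · exact (key h (by linear_combination q * h - h2)).elim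
  · have hα0 := hqα (by linear_combination h1 - h2)
    have h3 : α' * q' = 0 := by linear_combination h1 + hα0
    exact (key hα0 ((mul_eq_zero.mp h3).resolve_right hq'0)).elim
  · have hα0 := hqα (by linear_combination h2 - h1)
    exact (key hα0 (by linear_combination hα0 - h1)).elim
  · rcases mul_eq_zero.mp (show (1 - q * q') * α = 0 by linear_combination h2 + h1) with h | h
    · exact Or.inr (by linear_combination -h)
    · exact (key h (by linear_combination h - h1)).elim
  · rcases mul_eq_zero.mp (show (q' - q) * α = 0 by linear_combination -h2 - h1) with h | h
    · exact Or.inl (sub_eq_zero.mp h)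
    · exact (key h (by linear_combination q * h - h2)).elim
  · have h3 : (q - 1) * (q' * α) = 0 := by linear_combination h1 - h2
    have hα0 : α = 0 :=
      (mul_eq_zero.mp ((mul_eq_zero.mp h3).resolve_left hq1')).resolve_left hq'0
    exact (key hα0 (by linear_combination h1 + q' * hα0)).elim

end Endgame

/-! ## The `x`-pencil of `𝔖(q)` -/

section Slice
variable (K : Type u) [Field K]

/-- **The `x`-slice of `𝔖(q)` is `X ⊕ X^{(q)}`** (entry `(1,0)` of the second block scaled by
`q`). [cite: BlaserChristandlZuiddam2017, §2] -/
theorem Tmat_fam (q : K) : Tmat (fam K q) =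
    Matrix.fromBlocks (leafMat fun i j => (MvPolynomial.X (i, j) : Rx K)) 0 0
      (leafMat fun i j => MvPolynomial.X (i, j) * MvPolynomial.C (famW K q (i, j))) := by
  ext x x'
  rcases x with ⟨i, l⟩ | ⟨i, l⟩ <;> rcases x' with ⟨j, l'⟩ | ⟨j, l'⟩ <;>
  · obtain rfl : l = 0 := Subsingleton.elim _ _
    obtain rfl : l' = 0 := Subsingleton.elim _ _
    fin_cases i <;> fin_cases j <;>
      simp [Tmat, leafMat, Fintype.sum_prod_type, Fin.sum_univ_two, famW, matMulTensor]

/-- **`det T(x) = det X · det_q X`** for `𝔖(q)`. [cite: BlaserChristandlZuiddam2017, §2] -/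
theorem det_Tmat_fam (q : K) : (Tmat (fam K q)).det = detX K * detXq K q := by
  rw [Tmat_fam, Matrix.det_fromBlocks_zero₂₁, det_leafMat, det_leafMat, detX, detXq]
  simp only [famW_one_zero, famW_of_ne K q (b := (0, 0)) (by decide),
    famW_of_ne K q (b := (0, 1)) (by decide), famW_of_ne K q (b := (1, 1)) (by decide),
    map_one, mul_one]
  ring

end Slice

/-! ## The trailing identity of a degeneration `𝔖(q) ⊵ 𝔖(q')` -/

section Main
variable (K : Type u) [Field K]

/-- **The trailing identity.**  A degeneration `𝔖(q) ⊵_h 𝔖(q')` with middle border matrix `B`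
yields `det X · det_{q'} X = c · P · Q`, `P`, `Q` the trailing `ε`-coefficients of `u - v` and
`u - q v` (`u = y₀₀y₁₁`, `v = y₀₁y₁₀`, `y = Bᵀx`).
[cite: BurgisserClausenShokrollahi1997, (15.19)] -/
theorem trailing_identity {q q' : K} {h : ℕ} {A : Leaf2 → Leaf2 → K[X]}
    {B : Fin 2 × Fin 2 → Fin 2 × Fin 2 → K[X]} {C : Leaf2 → Leaf2 → K[X]}
    (hd : IsApproxRestriction h (fam K q) (fam K q') A B C) :
    ∃ c : K, detX K * detXq K q' = MvPolynomial.C c *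
      (yv B (0, 0) * yv B (1, 1) - yv B (0, 1) * yv B (1, 0)).trailingCoeff *
      (yv B (0, 0) * yv B (1, 1) -
        yv B (0, 1) * yv B (1, 0) * Polynomial.C (MvPolynomial.C q)).trailingCoeff := by
  obtain ⟨p, D, hpD, hD0⟩ := slice_identity hd (Equiv.refl _)
  rw [det_Smat_fam] at hpD
  rw [det_Tmat_fam] at hD0
  have hD : D.trailingCoeff = detX K * detXq K q' := by
    have h0 : D.coeff 0 ≠ 0 := by
      rw [hD0]; exact mul_ne_zero (detX_ne_zero K) (detXq_ne_zero K q')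
    have hn : D.natTrailingDegree = 0 :=
      Nat.le_zero.mp (Polynomial.natTrailingDegree_le_of_ne_zero h0)
    rw [Polynomial.trailingCoeff, hn, hD0]
  have hX : ∀ n : ℕ, ((Polynomial.X : (Rx K)[X]) ^ n).trailingCoeff = 1 := fun n => by
    rw [Polynomial.trailingCoeff, Polynomial.natTrailingDegree_X_pow, Polynomial.coeff_X_pow,
      if_pos rfl]
  have hp : (φK (Fin 2 × Fin 2) p).trailingCoeff =
      MvPolynomial.C (p.coeff (φK (Fin 2 × Fin 2) p).natTrailingDegree) := coeff_φK p _
  have htc := congrArg Polynomial.trailingCoeff hpD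
  rw [Polynomial.trailingCoeff_mul, Polynomial.trailingCoeff_mul, Polynomial.trailingCoeff_mul, hX,
    one_mul, hD, hp, ← mul_assoc] at htc
  exact ⟨_, htc⟩

/-- The two trailing coefficients are quadratic forms. [folklore] -/
theorem trailing_isHomogeneous (B : Fin 2 × Fin 2 → Fin 2 × Fin 2 → K[X]) (q : K) :
    ((yv B (0, 0) * yv B (1, 1) - yv B (0, 1) * yv B (1, 0)).trailingCoeff).IsHomogeneous 2 ∧
      ((yv B (0, 0) * yv B (1, 1) -
        yv B (0, 1) * yv B (1, 0) * Polynomial.C (MvPolynomial.C q)).trailingCoeff).IsHomogeneous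
        2 := by
  refine ⟨?_, ?_⟩
  · rw [Polynomial.trailingCoeff, Polynomial.coeff_sub]
    exact (coeff_yv_mul_isHomogeneous B _ _ _).sub (coeff_yv_mul_isHomogeneous B _ _ _)
  · rw [Polynomial.trailingCoeff, Polynomial.coeff_sub, Polynomial.coeff_mul_C]
    exact (coeff_yv_mul_isHomogeneous B _ _ _).sub
      ((coeff_yv_mul_isHomogeneous B _ _ _).mul (MvPolynomial.isHomogeneous_C _ q))

/-- **`𝔖(q) ⊵ 𝔖(q')`, `q ≠ 1`, `q' ≠ 0`, forces `q' = q ∨ q q' = 1`** (every field).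
[cite: BurgisserClausenShokrollahi1997, (15.19)] [cite: BlaserChristandlZuiddam2017, §2] -/
theorem fam_algDegeneratesTo_fam_of_ne_one {q q' : K} (hq1 : q ≠ 1) (hq'0 : q' ≠ 0)
    (hd : AlgDegeneratesTo (fam K q) (fam K q')) : q' = q ∨ q * q' = 1 := by
  obtain ⟨h, A, B, C, hd⟩ := hd
  obtain ⟨c, htc⟩ := trailing_identity K hd
  obtain ⟨hP, hQ⟩ := trailing_isHomogeneous K B q
  rcases pair_of_detX_mul_eq hP hQ (detXq_ne_zero K q') htc with
    ⟨⟨κ₁, hκ₁, h₁⟩, ⟨κ₂, hκ₂, h₂⟩⟩ | ⟨⟨κ₁, hκ₁, h₁⟩, ⟨κ₂, hκ₂, h₂⟩⟩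
  · rw [← detXq_one] at h₁
    obtain ⟨α, α', hne, C1, C2⟩ :=
      order_data hq1 one_ne_zero (yv B) (coeff_yv_isHomogeneous B) hκ₁ hκ₂ h₁ h₂
    exact endgame hq1 hq'0 (Or.inl ⟨rfl, rfl⟩) hne C1 C2
  · rw [← detXq_one] at h₂
    obtain ⟨α, α', hne, C1, C2⟩ :=
      order_data hq1 hq'0 (yv B) (coeff_yv_isHomogeneous B) hκ₁ hκ₂ h₁ h₂
    exact endgame hq1 hq'0 (Or.inr ⟨rfl, rfl⟩) hne C1 C2

/-- **`𝔖(1) ⊵ 𝔖(q')` forces `q' = 1`** (every field; here `P = Q`, so `det X ∣ P` and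
`det_{q'} X = c κ² det X`). [cite: BurgisserClausenShokrollahi1997, (15.19)] -/
theorem fam_one_algDegeneratesTo_fam_imp {q' : K} (hd : AlgDegeneratesTo (fam K 1) (fam K q')) :
    q' = 1 := by
  obtain ⟨h, A, B, C, hd⟩ := hd
  obtain ⟨c, htc⟩ := trailing_identity K hd
  obtain ⟨hP, -⟩ := trailing_isHomogeneous K B 1
  simp only [map_one, mul_one] at htc
  set P := (yv B (0, 0) * yv B (1, 1) - yv B (0, 1) * yv B (1, 0)).trailingCoeff with hPdef
  have h0 : detX K * detXq K q' ≠ 0 := mul_ne_zero (detX_ne_zero K) (detXq_ne_zero K q')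
  have hP0 : P ≠ 0 := fun e => h0 (by rw [htc, e, mul_zero])
  have hc0 : c ≠ 0 := fun e => h0 (by rw [htc, e, map_zero, zero_mul, zero_mul])
  have hdvd : detX K ∣ P := by
    have h1 : detX K ∣ MvPolynomial.C c * (P * P) := ⟨detXq K q', by rw [← mul_assoc, ← htc]⟩
    rcases (detX_prime K).dvd_or_dvd h1 with h3 | h3
    · exact absurd (isUnit_of_dvd_unit h3 ((isUnit_iff_ne_zero.mpr hc0).map MvPolynomial.C))
        (detX_prime K).not_unit
    · exact ((detX_prime K).dvd_or_dvd h3).elim id id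
  obtain ⟨κ, -, hP'⟩ := eq_C_mul_detX_of_dvd hP hP0 hdvd
  have h3 : detX K * (detXq K q' - MvPolynomial.C (c * κ ^ 2) * detX K) = 0 := by
    rw [mul_sub, htc, hP', map_mul, map_pow]
    ring
  exact detXq_eq_C_mul_detX_imp K
    (sub_eq_zero.mp ((mul_eq_zero.mp h3).resolve_left (detX_ne_zero K)))

/-- **`𝔖(q) ⊵ 𝔖(q')` with `q' ≠ 0` forces `q' = q ∨ q q' = 1`, for every `q`, over every field.**
[cite: BurgisserClausenShokrollahi1997, (15.19)] [cite: BlaserChristandlZuiddam2017, §2] -/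
theorem fam_algDegeneratesTo_fam_imp {q q' : K} (hq'0 : q' ≠ 0)
    (hd : AlgDegeneratesTo (fam K q) (fam K q')) : q' = q ∨ q * q' = 1 := by
  by_cases hq1 : q = 1
  · subst hq1
    exact Or.inl (fam_one_algDegeneratesTo_fam_imp K hd)
  · exact fam_algDegeneratesTo_fam_of_ne_one K hq1 hq'0 hd

/-! ## Headlines -/

/-- **`𝔖(1) ⋭ 𝔖(q')` for every `q' ≠ 1`** (incl. `q' = 0`), every field.
[cite: BurgisserClausenShokrollahi1997, (15.19)] -/
theorem fam_one_not_algDegeneratesTo_fam {q' : K} (hq' : q' ≠ 1) :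
    ¬ AlgDegeneratesTo (fam K 1) (fam K q') :=
  fun hd => hq' (fam_one_algDegeneratesTo_fam_imp K hd)

/-- **`𝔖(0)` reaches no other member of the line**: `𝔖(0) ⋭ 𝔖(q')` for `q' ≠ 0`, every field.
[cite: BurgisserClausenShokrollahi1997, (15.19)] -/
theorem fam_zero_not_algDegeneratesTo_fam {q' : K} (hq' : q' ≠ 0) :
    ¬ AlgDegeneratesTo (fam K 0) (fam K q') := fun hd => by
  rcases fam_algDegeneratesTo_fam_imp K hq' hd with h | h
  · exact hq' h
  · exact zero_ne_one (by rwa [zero_mul] at h)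

/-- **The generic stratum is an antichain of classes `{𝔖(q), 𝔖(q⁻¹)}`**: `𝔖(q)`, `𝔖(q')` with
`q, q' ≠ 0`, `q' ∉ {q, q⁻¹}` are degeneration-incomparable, every field.
[cite: BlaserChristandlZuiddam2017, §2] [cite: BurgisserClausenShokrollahi1997, (15.19)] -/
theorem generic_pair_incomparable {q q' : K} (hq0 : q ≠ 0) (hq'0 : q' ≠ 0) (hne : q' ≠ q)
    (hinv : q * q' ≠ 1) :
    ¬ AlgDegeneratesTo (fam K q) (fam K q') ∧ ¬ AlgDegeneratesTo (fam K q') (fam K q) :=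
  ⟨fun hd => (fam_algDegeneratesTo_fam_imp K hq'0 hd).elim hne hinv,
    fun hd => (fam_algDegeneratesTo_fam_imp K hq0 hd).elim (fun e => hne e.symm)
      fun e => hinv (by rwa [mul_comm] at e)⟩

end Main

/-! ## The order on the line, and `⟨2,2,2⟩`
(universe `0`, as `fam_one_restricts` and `fam_restrictsTo_fam_inv`) -/

section Line
variable (K : Type) [Field K]

/-- **`⟨2,2,2⟩ ⋭ 𝔖(q')` for every `q' ≠ 1`, every field** — by the determinant class alone
(`q' = 0` and characteristic `2` included). [cite: BurgisserClausenShokrollahi1997, (15.19)] -/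
theorem matMul_not_algDegeneratesTo_fam_detClass {q' : K} (hq' : q' ≠ 1) :
    ¬ AlgDegeneratesTo (matMulTensor K 2 2 (1 + 1)) (fam K q') :=
  fun hd =>
    fam_one_not_algDegeneratesTo_fam K hq' ((fam_one_restricts K).2.algDegeneratesTo_trans hd)

/-- **`⟨2,2,2⟩ ⋭ 𝔖(0)`: deleting one term of `⟨2,2,2⟩` is not a degeneration**, over every
field. [cite: Landsberg2017, §3.4.4] [cite: BurgisserClausenShokrollahi1997, (15.19)] -/
theorem matMul_not_algDegeneratesTo_fam_zero :
    ¬ AlgDegeneratesTo (matMulTensor K 2 2 (1 + 1)) (fam K 0) :=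
  matMul_not_algDegeneratesTo_fam_detClass K zero_ne_one

/-- **`⟨2,2,2⟩` and `⟨2,2,2⟩` minus a term are degeneration-incomparable**, every field.
[cite: BurgisserClausenShokrollahi1997, (15.19)] [cite: Landsberg2017, §3.4.4] -/
theorem matMul_fam_zero_incomparable :
    ¬ AlgDegeneratesTo (matMulTensor K 2 2 (1 + 1)) (fam K 0) ∧
      ¬ AlgDegeneratesTo (fam K 0) (matMulTensor K 2 2 (1 + 1)) :=
  ⟨matMul_not_algDegeneratesTo_fam_zero K, fam_zero_not_algDegeneratesTo_matMul K⟩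

/-- **The degeneration order on the BCZ line**: for `q' ≠ 0 ∨ q ∈ {0,1}`,
`𝔖(q) ⊵ 𝔖(q') ↔ q' = q ∨ q q' = 1` — degeneration on the line is the inversion involution
(the pairs `𝔖(q) → 𝔖(0)`, `q ∉ {0,1}`, are the only ones not decided here).
[cite: BlaserChristandlZuiddam2017, §2] [cite: BurgisserClausenShokrollahi1997, (15.19), §20.2] -/
theorem fam_algDegeneratesTo_fam_iff {q q' : K} (h0 : q' = 0 → q = 0 ∨ q = 1) :
    AlgDegeneratesTo (fam K q) (fam K q') ↔ q' = q ∨ q * q' = 1 := by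
  constructor
  · intro hd
    by_cases hq'0 : q' = 0
    · rcases h0 hq'0 with hq | hq
      · exact Or.inl (hq'0.trans hq.symm)
      · subst hq
        exact Or.inl (fam_one_algDegeneratesTo_fam_imp K hd)
    · exact fam_algDegeneratesTo_fam_imp K hq'0 hd
  · rintro (rfl | h)
    · exact (TensorRestrictsTo.refl _).algDegeneratesTo
    · have hq0 : q ≠ 0 := fun e => zero_ne_one (by rwa [e, zero_mul] at h)
      rw [eq_inv_of_mul_eq_one_right h]
      exact (fam_restrictsTo_fam_inv hq0).algDegeneratesTo

/-- **On the BCZ line degeneration is restriction** (same proviso).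
[cite: BlaserChristandlZuiddam2017, §2] [cite: BurgisserClausenShokrollahi1997, §20.2] -/
theorem fam_algDegeneratesTo_iff_restrictsTo {q q' : K} (h0 : q' = 0 → q = 0 ∨ q = 1) :
    AlgDegeneratesTo (fam K q) (fam K q') ↔ TensorRestrictsTo (fam K q) (fam K q') := by
  refine ⟨fun hd => ?_, fun h => h.algDegeneratesTo⟩
  rcases (fam_algDegeneratesTo_fam_iff K h0).mp hd with e | h
  · rw [e]; exact TensorRestrictsTo.refl _
  · have hq0 : q ≠ 0 := fun e => zero_ne_one (by rwa [e, zero_mul] at h)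
    rw [eq_inv_of_mul_eq_one_right h]
    exact fam_restrictsTo_fam_inv hq0

/-- **No strict degeneration along the line**: `𝔖(q) ⊵ 𝔖(q') ↔ 𝔖(q') ⊵ 𝔖(q)` (outside the
undecided pairs with target `𝔖(0)`). [cite: BurgisserClausenShokrollahi1997, §20.2] -/
theorem line_symmetric {q q' : K} (h0 : q' = 0 → q = 0 ∨ q = 1) (h0' : q = 0 → q' = 0 ∨ q' = 1) :
    AlgDegeneratesTo (fam K q) (fam K q') ↔ AlgDegeneratesTo (fam K q') (fam K q) := by
  rw [fam_algDegeneratesTo_fam_iff K h0, fam_algDegeneratesTo_fam_iff K h0']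
  constructor <;> rintro (e | h)
  · exact Or.inl e.symm
  · exact Or.inr (by rwa [mul_comm] at h)
  · exact Or.inl e.symm
  · exact Or.inr (by rwa [mul_comm] at h)

/-- **`⟨2,2,2⟩` is `⊴`-isolated on the closed line**: `⟨2,2,2⟩ ⊵ 𝔖(q') ↔ q' = 1 ↔ 𝔖(q') ⊵ ⟨2,2,2⟩`,
every field (both ends `q' = 0` included). [cite: BurgisserClausenShokrollahi1997, (15.19)] -/
theorem matMul_comparable_iff (q' : K) :
    (AlgDegeneratesTo (matMulTensor K 2 2 (1 + 1)) (fam K q') ↔ q' = 1) ∧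
      (AlgDegeneratesTo (fam K q') (matMulTensor K 2 2 (1 + 1)) ↔ q' = 1) := by
  refine ⟨⟨fun hd => by_contra fun hq' => matMul_not_algDegeneratesTo_fam_detClass K hq' hd,
    fun e => ?_⟩, ⟨fun hd => by_contra fun hq' => fam_not_algDegeneratesTo_matMul K hq' hd,
    fun e => ?_⟩⟩
  · rw [e]; exact (fam_one_restricts K).1.algDegeneratesTo
  · rw [e]; exact (fam_one_restricts K).2.algDegeneratesTo

end Line

end Summit.MatrixMultiplication.MatrixMultiplication.Theorems.FarEdgeDescentLineRigidity

end
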